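import Summits.QuantumFields.BalabanUV.T4Continuum.Support.ShellMeasureLinearizedEndGammaT
import Summits.QuantumFields.BalabanUV.T4Continuum.Support.ShellMeasureAverageIterateRegular

/-!
# `T4Continuum.ShellMeasureAverageLandauCorrection` — W-a (Cf) FOR THE PRINTED AVERAGE [B7] (15): END-II's LANDAU-CORRECTION
# BINDER PAIR `hCq` ∕ `hCd` («`‖C Z‖ ≤ C₂‖Z‖²` on a ball, `C` holomorphic there») IS KERNEL for `C := C̃_V = Q̃_V − DQ̃_V(0)`,
# the nonlinear part of the printed block average in the chart, at every unit-bounded loop-regular background — and at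
# every averaged background `Ū₀ʲ`, `j ≤ k`, from print's (52) ALONE
(cell `pub-balaban`, sub-cell `t4`, spine estimate NE7c (node U5b); NE7c ROUND-2 crew `t4-ne7c-formalise-*`, unit
`b2b-balaban-t4-ne7c-formalise-leaf-01` gen 5; ADDITIVE — imports S60 f2 `ShellMeasureLinearizedEndGammaT` (p220060; hence
S49 f2, S52, S46, row D4's `LinearizingChange267FromQ`) and S59 `ShellMeasureAverageIterateRegular` (p219864) BY NAME,
modifies nothing; [folklore] bookkeeping; 0 `def`, 0 `def … : Prop`, 0 sorry, 0 citation tags)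

HONEST FRAMING.  Finite four-torus programme, rung (B)+1 only — NOT infinite volume, NOT a mass gap, NOT the Clay
problem, NOT summit progress; (B), `BetaPertHyp`, (B^μ) not consumed.  NE7c (`T4IndicatorShell.ShellWeightBound`) is
NOT PRINTED and NOT PROVED; «NE7c ⇐ the named binders» (trigger c3).  WHAT IS KERNEL HERE: the two Landau-correction
binders of the live-slot END of record (`ShellMeasureLandauHolonomyPrint.slotAC_realized_su2_landauChart_print`:
`hCq : ∀ V, ∀ Z, ‖Z‖ < R_C → ‖Cf V Z‖ ≤ C₂ * ‖Z‖ ^ 2`, `hCd : ∀ V, DifferentiableOn ℂ (Cf V) (ball 0 R_C)`; WALL §2 (a) item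
«the Landau correction `Cf V`, holomorphic on `ball 0 R_C` with `‖Cf V Z‖ ≤ C₂‖Z‖²` (B11 Prop. 3 (54)–(55), Sect. C)») are
THEOREMS when `Cf V` is read as the nonlinear part `C̃_V := nonlin (Q̃_V)` (row D4's `LinearizingChange267FromQ.nonlin`)
of the PRINTED one-step average (15) in the chart (`ShellMeasureLinearizedGammaT.QtΓ`), with the CRUDE one-step constants
`R_C = 1∕(2816(d+1)L)`, `C₂ = Mq R_C 1 = 2·(2816(d+1)L)²`, under print's regime hypotheses on the background (unit
bounds, `ε`-regular off-axis block loops, `ε ≤ 1∕8`) — and, for the AVERAGED backgrounds `Ū₀ʲ` of [Balaban1985Averaging]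
(43), under print's (52) ALONE (S59 ∘ b07's kernel Proposition 2).  PLACE IN THE CREW's (Cf) JUNCTION (journal
`CLAIMS.log` COORDINATION leaf-08-g11 ∕ ACK leaf-01-g5): this ONE-STEP per-bond pair is the `k = 1` face at a single coarse
bond — a readability ∕ non-vacuity companion; the `j`-FOLD correction `C_j` that [Balaban1985Variational] (44)∕(50) actually
uses («`C(A,c) = C_j(LʲηA, c)`»), END-II's real-structure clause `hCr` and the uniqueness of the linear part are leaf-08-g11's
`ShellMeasureLandauCorrectionFromQ` ∕ `ShellMeasureLandauCorrectionIterate` (generic `landauCf`; no declaration of theirs is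
restated here, no import either way).  WHAT IS NOT: (i) the k-UNIFORM constant of
[Balaban1985Averaging] Prop. 4∕7 ∕ [Balaban1985Variational] (44) (rows S55∕S56: Prop. 3's sharp linear part) — the radius
here SHRINKS with the level through the regime only, not through `k`, but the constant is the crude `2∕R_C²`; (ii) the
identification of END-II's `Cf V` slot with THIS `C̃` for Bałaban's minimisers `U_k` (the [dict]∕W-a reading: for `U_k`
the regime is the printed regularity TYPE, B11 (19)–(21) ∕ B14 (2.16)–(2.17), DISPLAYED); (iii) anything at a live level
of Bałaban's induction.  Nothing of the manuscripts is asserted.  HONEST DEPENDENCY (cell, verbatim): continuum YM on T⁴ ⇐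
BetaPertH ∧ nine spine estimates (0/9 proved); BetaPertH ⇐ (D1) ∧ (D4) ∧ CAP+tail; G-an2-4 gates asym, D1 and NE2/3/4.

CONTENT (all [folklore]; every analytic input BY NAME).
* §1 ONE BACKGROUND: `Mq_crude_eq` (`Mq R_C 1 = 2·(2816(d+1)L)²`), `nonlin_QtΓ_zero`, `analyticOnNhd_nonlin_QtΓ`,
  **`quadAnalytic_nonlin_QtΓ`** (B13's `QuadAnalytic (nonlin (QtΓ L V c)) (Mq R_C 1) R_C` — S46 `quadAnalytic_nonlin_of_Q` fed
  by S49 f2 `analyticOnNhd_Qtilde_gammaT`, S52 `QtΓ_zero`, S60 f2 `QtΓ_bound_one`), **`hCq_QtΓ`**, **`hCd_QtΓ`** (END-II's two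
  binder SHAPES literally), `hCq_QtΓ_explicit` (constant `2·(2816(d+1)L)²`).
* §2 EXTERIOR-INDEXED FAMILY: **`landauCorrection_pair_gammaT`** — for `V : Z → (bonds → 𝔸ˣ)` under the regime UNIFORM in
  `z`: `0 ≤ C₂ ∧ (∀ z Z, ‖Z‖ < R_C → ‖C̃_{V z} Z‖ ≤ C₂‖Z‖²) ∧ (∀ z, DifferentiableOn ℂ C̃_{V z} (ball 0 R_C))` — the triple
  `hC₂`∕`hCq`∕`hCd` of the END of record in ONE statement, `Cf z := nonlin (QtΓ L (V z) c)`.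
* §3 THE AVERAGED BACKGROUNDS FROM (52): **`quadAnalytic_nonlin_level`**, **`landauCorrection_pair_level`** — the same at
  `V := Ū₀ʲ = uncurry (B7Prop2Explicit.avgIter L (curry U) j)`, every `j ≤ k`, hypotheses = S59 §2's (`2 ≤ L`, `AvgClosed`
  gauge group, `0 < α₀`, `C₀α₀ ≤ ⅓`, `2α₀ ≤ c₂′`, (52)) — NO regime binder (S59 `norm_level_le_one` ∕ `norm_level_inv_le_one` ∕
  `loop_level_le_const` supply it, `ε = 1∕32`); `landauCorrection_pair_level_unitary` — print's gauge group `U(N)`.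
* §5 PLAQUETTE-REGULAR BACKGROUNDS (the owner's f5 ∕ S60 f2 §3 route, [Balaban1987RG1] p. 254 TYPE): **`landauCorrection_pair_plaquette`**
  — the triple for unit-bounded backgrounds with `‖V z (∂p) − 1‖ ≤ ε₀` at every plaquette, `1 ≤ d`, `24·d·L^{d+1}·ε₀ < 1` (loop
  regime `ε := ω(ε₀)` by `B12PlaquetteLoop267.norm_loopW_sub_one_le` ∕ `thresholds_of_small`).
-/

noncomputable section

open Set Metric Function

namespace Summit.QuantumFields.BalabanUV.T4Continuum.ShellMeasureAverageLandauCorrection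

open Literature.MathematicalPhysics.QuantumFieldTheory.Balaban1983to89
open Literature.MathematicalPhysics.QuantumLattice (ZdEdge plaquetteHolonomyZd)
open B8Lemma1NonAbelian (omegaC omegaC_nonneg)
open B12PlaquetteLoop267 (norm_loopW_sub_one_le thresholds_of_small)
open B7BlockGeometry (qppBonds)
open B12HOperator267 (gammaT)
open B12AverageCorridor267 (loopW offAxis Qtilde)
open B13Contraction113 (QuadAnalytic)
open Summit.QuantumFields.BalabanUV.Beta.LinearizingChange267FromQ (nonlin Mq analyticOnNhd_nonlin nonlin_zero)
open ShellMeasureLinearizedFromQ (quadAnalytic_nonlin_of_Q Mq_nonneg_of_Q)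
open ShellMeasureAverageAnalyticB7 (analyticOnNhd_Qtilde_gammaT)
open ShellMeasureLinearizedGammaT (QtΓ QtΓ_zero)
open ShellMeasureLinearizedEndGammaT (QtΓ_bound_one)
open ShellMeasureAverageIterateRegular (norm_level_le_one norm_level_inv_le_one loop_level_le_const)
open B7Prop2Explicit (avgIter pdev C0 c2' AvgClosed unitaryUnits avgClosed_unitaryUnits)

variable {d : ℕ} {𝔸 : Type*} [NormedRing 𝔸] [NormedAlgebra ℂ 𝔸] [CompleteSpace 𝔸] [NormOneClass 𝔸] {L : ℕ}
  {c : ZdEdge d}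

/-! ## §1 One background: `C̃_V := nonlin (Q̃_V)` for the printed average -/

/-- The crude one-step constant: `Mq R_C 1 = 2∕R_C² = 2·(2816(d+1)L)²` for `R_C = 1∕(2816(d+1)L)`. [folklore] -/
theorem Mq_crude_eq :
    Mq (1 / (2816 * ((d : ℝ) + 1) * L)) 1 = 2 * (2816 * ((d : ℝ) + 1) * L) ^ 2 := by
  simp only [Mq]
  rw [one_div, inv_pow, div_eq_mul_inv, inv_inv, mul_one]

omit [NormOneClass 𝔸] in
/-- `C̃_V(0) = 0`. [folklore] -/
theorem nonlin_QtΓ_zero (V : ZdEdge d → 𝔸ˣ) : nonlin (QtΓ L V c) 0 = 0 := by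
  simp only [nonlin, map_zero, sub_zero]
  exact QtΓ_zero L V c

section One

variable (hL : 0 < L) {V : ZdEdge d → 𝔸ˣ}
  (hV : ∀ b, ‖((V b : 𝔸ˣ) : 𝔸)‖ ≤ 1) (hV' : ∀ b, ‖(((V b)⁻¹ : 𝔸ˣ) : 𝔸)‖ ≤ 1) {ε : ℝ} (hε0 : 0 ≤ ε) (hε : ε ≤ 1 / 8)
  (hWc : ∀ x ∈ offAxis L c, ‖((loopW L (fun U : ZdEdge d → 𝔸ˣ => gammaT L U) V c x : 𝔸ˣ) : 𝔸) - 1‖ ≤ ε)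
include hL hV hV' hε0 hε hWc

/-- **`C̃_V` IS HOLOMORPHIC ON THE CHART BALL** `ball 0 (1∕(2816(d+1)L))` — S49 f2's analyticity of `Q̃_V` minus its
(continuous linear) derivative at `0` (row D4 `analyticOnNhd_nonlin`). [folklore] -/
theorem analyticOnNhd_nonlin_QtΓ :
    AnalyticOnNhd ℂ (nonlin (QtΓ L V c)) (ball 0 (1 / (2816 * ((d : ℝ) + 1) * L))) :=
  analyticOnNhd_nonlin (analyticOnNhd_Qtilde_gammaT hL hV hV' hε0 hε hWc)

/-- **`C̃_V` IS QUADRATIC-ANALYTIC** (B13's `QuadAnalytic`) with the crude constants `C₂ = Mq R_C 1`, `R_C = 1∕(2816(d+1)L)`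
— S46 `quadAnalytic_nonlin_of_Q` fed by (Q1) S49 f2 `analyticOnNhd_Qtilde_gammaT`, (Q3) S60 f2 `QtΓ_bound_one` (`M_Q = 1`),
(Q2) S52 `QtΓ_zero`. [folklore] -/
theorem quadAnalytic_nonlin_QtΓ :
    QuadAnalytic (nonlin (QtΓ L V c)) (Mq (1 / (2816 * ((d : ℝ) + 1) * L)) 1) (1 / (2816 * ((d : ℝ) + 1) * L)) := by
  have hLr : (0 : ℝ) < L := by exact_mod_cast hL
  have hR : (0 : ℝ) < 1 / (2816 * ((d : ℝ) + 1) * L) := by positivity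
  exact quadAnalytic_nonlin_of_Q hR (analyticOnNhd_Qtilde_gammaT hL hV hV' hε0 hε hWc)
    (QtΓ_bound_one hL hV hV' hε0 hε hWc) (QtΓ_zero L V c)

/-- **END-II's `hCq` FOR `Cf V := C̃_V`** — `‖C̃_V Z‖ ≤ C₂‖Z‖²` on `‖Z‖ < R_C`, in the END of record's binder shape
(`ShellMeasureLandauHolonomyPrint.slotAC_realized_su2_landauChart_print`'s `hCq`), `C₂ = Mq R_C 1`. [folklore] -/
theorem hCq_QtΓ : ∀ Z : ↥(qppBonds L c) → 𝔸, ‖Z‖ < 1 / (2816 * ((d : ℝ) + 1) * L) →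
    ‖nonlin (QtΓ L V c) Z‖ ≤ Mq (1 / (2816 * ((d : ℝ) + 1) * L)) 1 * ‖Z‖ ^ 2 :=
  (quadAnalytic_nonlin_QtΓ hL hV hV' hε0 hε hWc).quad

/-- … with the constant written out: `C₂ = 2·(2816(d+1)L)²`. [folklore] -/
theorem hCq_QtΓ_explicit : ∀ Z : ↥(qppBonds L c) → 𝔸, ‖Z‖ < 1 / (2816 * ((d : ℝ) + 1) * L) →
    ‖nonlin (QtΓ L V c) Z‖ ≤ 2 * (2816 * ((d : ℝ) + 1) * L) ^ 2 * ‖Z‖ ^ 2 := by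
  rw [← Mq_crude_eq]
  exact hCq_QtΓ hL hV hV' hε0 hε hWc

/-- **END-II's `hCd` FOR `Cf V := C̃_V`** — `DifferentiableOn ℂ C̃_V (ball 0 R_C)` (the END of record's `hCd` shape).
[folklore] -/
theorem hCd_QtΓ : DifferentiableOn ℂ (nonlin (QtΓ L V c)) (ball 0 (1 / (2816 * ((d : ℝ) + 1) * L))) :=
  (analyticOnNhd_nonlin_QtΓ hL hV hV' hε0 hε hWc).differentiableOn

end One

/-! ## §2 The END of record's triple `hC₂` ∕ `hCq` ∕ `hCd` for an exterior-indexed family of backgrounds -/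

/-- **THE LANDAU-CORRECTION BINDER TRIPLE OF THE LIVE-SLOT END, FOR THE PRINTED AVERAGE, FROM THE REGIME ALONE.**  For any
index type `Z` (exterior sections) and backgrounds `V z` obeying print's regime UNIFORMLY in `z` (unit bounds, off-axis block
loops at the coarse bond `c` within `ε ≤ 1∕8` of `1`): with `Cf z := nonlin (QtΓ L (V z) c)`, `R_C := 1∕(2816(d+1)L)`,
`C₂ := Mq R_C 1` — `0 ≤ C₂`, `∀ z Z, ‖Z‖ < R_C → ‖Cf z Z‖ ≤ C₂‖Z‖²`, `∀ z, DifferentiableOn ℂ (Cf z) (ball 0 R_C)`: the three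
binders `hC₂`∕`hCq`∕`hCd` of `ShellMeasureLandauHolonomyPrint.slotAC_realized_su2_landauChart_print` in ONE statement (to be fed
with `Cf := fun V => nonlin (QtΓ L (background V) c)`).  For Bałaban's minimisers the regime itself stays the DISPLAYED W-a-type
binder; the identification of the END's `Cf` slot with this `C̃` is the [dict] reading — NOT proved here. [folklore] -/
theorem landauCorrection_pair_gammaT (hL : 0 < L) {Z : Type*} {V : Z → ZdEdge d → 𝔸ˣ}
    (hV : ∀ z b, ‖((V z b : 𝔸ˣ) : 𝔸)‖ ≤ 1) (hV' : ∀ z b, ‖(((V z b)⁻¹ : 𝔸ˣ) : 𝔸)‖ ≤ 1) {ε : ℝ} (hε0 : 0 ≤ ε)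
    (hε : ε ≤ 1 / 8)
    (hWc : ∀ z, ∀ x ∈ offAxis L c, ‖((loopW L (fun U : ZdEdge d → 𝔸ˣ => gammaT L U) (V z) c x : 𝔸ˣ) : 𝔸) - 1‖ ≤ ε) :
    0 ≤ Mq (1 / (2816 * ((d : ℝ) + 1) * L)) 1 ∧
      (∀ z, ∀ Z : ↥(qppBonds L c) → 𝔸, ‖Z‖ < 1 / (2816 * ((d : ℝ) + 1) * L) →
        ‖nonlin (QtΓ L (V z) c) Z‖ ≤ Mq (1 / (2816 * ((d : ℝ) + 1) * L)) 1 * ‖Z‖ ^ 2) ∧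
      ∀ z, DifferentiableOn ℂ (nonlin (QtΓ L (V z) c)) (ball 0 (1 / (2816 * ((d : ℝ) + 1) * L))) := by
  refine ⟨?_, fun z => hCq_QtΓ hL (hV z) (hV' z) hε0 hε (hWc z), fun z => hCd_QtΓ hL (hV z) (hV' z) hε0 hε (hWc z)⟩
  rw [Mq_crude_eq]
  positivity

/-! ## §3 At the averaged backgrounds `Ū₀ʲ`, `j ≤ k`, from print's (52) alone (S59 ∘ b07 Prop. 2) -/

section Level

variable (hL : 2 ≤ L) {G : Subgroup 𝔸ˣ} (hG : AvgClosed d L G) (k : ℕ) (U : ZdEdge d → 𝔸ˣ) (hU : ∀ b, U b ∈ G)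
  {α₀ : ℝ} (hα : 0 < α₀) (hα3 : C0 d * α₀ ≤ 1 / 3) (hα2 : 2 * α₀ ≤ c2' d L)
  (h52 : pdev (Function.curry U) < α₀ * (((L : ℝ) ^ k)⁻¹) ^ 2)
include hL hG hU hα hα3 hα2 h52

/-- **`C̃` AT THE LEVEL-`j` AVERAGED BACKGROUND `Ū₀ʲ` IS QUADRATIC-ANALYTIC, FROM (52) ALONE** (`j ≤ k`): §1 with the three
regime binders supplied by S59 `norm_level_le_one` ∕ `norm_level_inv_le_one` ∕ `loop_level_le_const` (`ε = 1∕32`); hypotheses =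
b07 `prop2_explicit`'s + nothing. [folklore] -/
theorem quadAnalytic_nonlin_level {j : ℕ} (hj : j ≤ k) (c : ZdEdge d) :
    QuadAnalytic (nonlin (QtΓ L (Function.uncurry (avgIter L (Function.curry U) j)) c))
      (Mq (1 / (2816 * ((d : ℝ) + 1) * L)) 1) (1 / (2816 * ((d : ℝ) + 1) * L)) :=
  quadAnalytic_nonlin_QtΓ (lt_of_lt_of_le (by norm_num) hL) (norm_level_le_one hL hG k U hU hα hα3 hα2 h52 hj)
    (norm_level_inv_le_one hL hG k U hU hα hα3 hα2 h52 hj) (by norm_num : (0 : ℝ) ≤ 1 / 32)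
    (by norm_num : (1 : ℝ) / 32 ≤ 1 / 8) (fun x hx => loop_level_le_const hL hG k U hU hα hα3 hα2 h52 hj c hx)

/-- **THE END's LANDAU-CORRECTION TRIPLE ALONG THE AVERAGING PYRAMID, FROM (52) ALONE**: for every `j ≤ k` and every coarse
bond `c`, with `Cf := nonlin (QtΓ L Ū₀ʲ c)`: `0 ≤ C₂`, the quadratic bound on `‖Z‖ < R_C`, holomorphy on `ball 0 R_C`
(`C₂ = Mq R_C 1 = 2·(2816(d+1)L)²`) — NO regime binder. [folklore] -/
theorem landauCorrection_pair_level :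
    0 ≤ Mq (1 / (2816 * ((d : ℝ) + 1) * L)) 1 ∧
      (∀ j ≤ k, ∀ (c : ZdEdge d) (Z : ↥(qppBonds L c) → 𝔸), ‖Z‖ < 1 / (2816 * ((d : ℝ) + 1) * L) →
        ‖nonlin (QtΓ L (Function.uncurry (avgIter L (Function.curry U) j)) c) Z‖
          ≤ Mq (1 / (2816 * ((d : ℝ) + 1) * L)) 1 * ‖Z‖ ^ 2) ∧
      ∀ j ≤ k, ∀ c : ZdEdge d, DifferentiableOn ℂ (nonlin (QtΓ L (Function.uncurry (avgIter L (Function.curry U) j)) c))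
        (ball 0 (1 / (2816 * ((d : ℝ) + 1) * L))) := by
  refine ⟨?_, fun j hj c => (quadAnalytic_nonlin_level hL hG k U hU hα hα3 hα2 h52 hj c).quad, fun j hj c => ?_⟩
  · rw [Mq_crude_eq]
    positivity
  · exact (analyticOnNhd_nonlin_QtΓ (lt_of_lt_of_le (by norm_num) hL) (norm_level_le_one hL hG k U hU hα hα3 hα2 h52 hj)
      (norm_level_inv_le_one hL hG k U hU hα hα3 hα2 h52 hj) (by norm_num : (0 : ℝ) ≤ 1 / 32)
      (by norm_num : (1 : ℝ) / 32 ≤ 1 / 8)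
      (fun x hx => loop_level_le_const hL hG k U hU hα hα3 hα2 h52 hj c hx)).differentiableOn

end Level

/-! ## §4 Print's gauge group: unitary-valued configurations (`U(N)`; `M_N(ℂ)` with the operator norm) -/

section Unitary

variable {𝔹 : Type*} [CStarAlgebra 𝔹] [Nontrivial 𝔹]

/-- **THE TRIPLE ALONG THE PYRAMID FOR `U(N)`-VALUED CONFIGURATIONS UNDER (52)** (the unitary group of a non-trivial
C⋆-algebra is averaging-closed: `B7Prop2Explicit.avgClosed_unitaryUnits`). [folklore] -/
theorem landauCorrection_pair_level_unitary (hL : 2 ≤ L) (k : ℕ) (U : ZdEdge d → 𝔹ˣ)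
    (hU : ∀ b, U b ∈ unitaryUnits 𝔹) {α₀ : ℝ} (hα : 0 < α₀) (hα3 : C0 d * α₀ ≤ 1 / 3) (hα2 : 2 * α₀ ≤ c2' d L)
    (h52 : pdev (Function.curry U) < α₀ * (((L : ℝ) ^ k)⁻¹) ^ 2) :
    0 ≤ Mq (1 / (2816 * ((d : ℝ) + 1) * L)) 1 ∧
      (∀ j ≤ k, ∀ (c : ZdEdge d) (Z : ↥(qppBonds L c) → 𝔹), ‖Z‖ < 1 / (2816 * ((d : ℝ) + 1) * L) →
        ‖nonlin (QtΓ L (Function.uncurry (avgIter L (Function.curry U) j)) c) Z‖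
          ≤ Mq (1 / (2816 * ((d : ℝ) + 1) * L)) 1 * ‖Z‖ ^ 2) ∧
      ∀ j ≤ k, ∀ c : ZdEdge d, DifferentiableOn ℂ (nonlin (QtΓ L (Function.uncurry (avgIter L (Function.curry U) j)) c))
        (ball 0 (1 / (2816 * ((d : ℝ) + 1) * L))) :=
  landauCorrection_pair_level hL (avgClosed_unitaryUnits d L) k U hU hα hα3 hα2 h52

end Unitary

/-! ## §5 Plaquette-regular backgrounds ([B12] p. 254 TYPE regime; the owner's f5 ∕ S60 f2 §3 route) -/

/-- **THE TRIPLE FOR UNIT-BOUNDED, PLAQUETTE-REGULAR EXTERIOR-INDEXED BACKGROUNDS**: `‖V z (∂p) − 1‖ ≤ ε₀` for every plaquette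
(`i ≠ j`), `1 ≤ d`, `24·d·L^{d+1}·ε₀ < 1` ⟹ with `Cf z := nonlin (QtΓ L (V z) c)`: `0 ≤ C₂`, the quadratic bound on
`‖Z‖ < R_C`, holomorphy on `ball 0 R_C` — §2 with the loop regime `ε := ω(ε₀) ≤ 1∕8` supplied by `B12PlaquetteLoop267`
(`norm_loopW_sub_one_le`, `thresholds_of_small`).  For Bałaban's `U_k` this plaquette regularity is the printed TYPE (B11
(19)–(21) ∕ B14 (2.16)–(2.17)) — a DISPLAYED binder of the W-a family, not discharged here. [folklore] -/
theorem landauCorrection_pair_plaquette (hL : 0 < L) (hd : 1 ≤ d) {Z : Type*} {V : Z → ZdEdge d → 𝔸ˣ}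
    (hV : ∀ z b, ‖((V z b : 𝔸ˣ) : 𝔸)‖ ≤ 1) (hV' : ∀ z b, ‖(((V z b)⁻¹ : 𝔸ˣ) : 𝔸)‖ ≤ 1) {ε₀ : ℝ} (hε₀ : 0 ≤ ε₀)
    (hsmall : 24 * (d : ℝ) * (L : ℝ) ^ (d + 1) * ε₀ < 1)
    (h44 : ∀ z (p : Fin d → ℤ) (i j : Fin d), i ≠ j → ‖((plaquetteHolonomyZd (V z) p i j : 𝔸ˣ) : 𝔸) - 1‖ ≤ ε₀) :
    0 ≤ Mq (1 / (2816 * ((d : ℝ) + 1) * L)) 1 ∧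
      (∀ z, ∀ Z : ↥(qppBonds L c) → 𝔸, ‖Z‖ < 1 / (2816 * ((d : ℝ) + 1) * L) →
        ‖nonlin (QtΓ L (V z) c) Z‖ ≤ Mq (1 / (2816 * ((d : ℝ) + 1) * L)) 1 * ‖Z‖ ^ 2) ∧
      ∀ z, DifferentiableOn ℂ (nonlin (QtΓ L (V z) c)) (ball 0 (1 / (2816 * ((d : ℝ) + 1) * L))) :=
  landauCorrection_pair_gammaT hL hV hV' (omegaC_nonneg hL hd hε₀) (thresholds_of_small hL hd hε₀ hsmall).1
    fun z => norm_loopW_sub_one_le hL (V z) (hV z) (hV' z) hε₀ (h44 z) c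

end Summit.QuantumFields.BalabanUV.T4Continuum.ShellMeasureAverageLandauCorrection

end
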